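import Mathlib
import Summits.Ventures.HodgeRepro2.T5QuadraticTrace
import Summits.Ventures.HodgeRepro2.T5DecompositionOrder
import Summits.Ventures.HodgeRepro2.T5CMTypeGaloisDialect

/-!
# T5CMConjugation — the CM conjugation, trace and norm of a CM field in Mathlib's vocabulary
(Tier-5 N2 / B1 support)

Mathlib's `NumberField.IsCMField K` carries the complex conjugation `complexConj K : Gal(K/K⁺)`
(`K⁺ = maximalRealSubfield K`), with `complexEmbedding_complexConj : φ (c z) = conj (φ z)` for EVERY
embedding `φ : K →+* ℂ`.  This file reads the seat's quadratic-extension lemmas (`T5QuadraticTrace`)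
and the cyclic-group lemma of `T5DecompositionOrder` on that structure:

* `Gal(K/K⁺) = {1, c}`, `tr_{K/K⁺} z = z + c z`, `N_{K/K⁺} z = z · c z`
  (`univ_gal_eq_pair`, `algebraMap_trace_eq_add_complexConj`, `algebraMap_norm_eq_mul_complexConj`);
* the norm form is TOTALLY POSITIVE: `φ (N z) = |φ z|²` for every complex embedding,
  `w (N z) = (w z)²` at every infinite place, and `0 ≤ ψ (N z)` with `0 < ψ (N z) ⟺ z ≠ 0` for
  every real embedding `ψ : maximalRealSubfield K →+* ℝ` (`realEmbedding_norm_nonneg`, `realEmbedding_norm_pos_iff`);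
* `N_{K/ℚ} z ≥ 0` for every element of a CM field (`norm_rat_nonneg`);
* for `K/ℚ` Galois with CYCLIC Galois group (the brief's sextic case), the conjugation — p7's
  `conjGal K = (complexConj K).restrictScalars ℚ` (`T5CMTypeGaloisDialect`, not re-declared) — is
  the UNIQUE involution of `Gal(K/ℚ)`: `c = g^m` for every generator `g` when `|Gal| = 2m`, in
  particular `c = g³` for `|Gal| = 6` — T4A §3.2's «c = g³» with `c` Mathlib's complex conjugation
  (`conjGal_eq_pow`, `conjGal_eq_pow_three`).

Prose (unchanged): that the brief's `E` / `F⁺` ARE `K` / `K⁺` of a Mathlib `IsCMField` (the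
instantiation), and everything about hermitian spaces over them.
-/

namespace Summit.Ventures.HodgeRepro2.T5CMConjugation

open Summit.Ventures.HodgeRepro2 NumberField NumberField.IsCMField
open scoped ComplexConjugate

variable (K : Type*) [Field K] [NumberField K] [IsCMField K]

section TraceNorm

/-- `Gal(K/K⁺) = {1, c}` for the complex conjugation `c` of a CM field. -/
theorem univ_gal_eq_pair [DecidableEq (K ≃ₐ[maximalRealSubfield K] K)] :
    (Finset.univ : Finset (K ≃ₐ[maximalRealSubfield K] K)) = {1, complexConj K} :=
  T5QuadraticTrace.univ_eq_pair (Algebra.IsQuadraticExtension.finrank_eq_two (maximalRealSubfield K) K) _ (complexConj_ne_one K)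

/-- **The CM trace**: `tr_{K/K⁺} z = z + c z`. -/
theorem algebraMap_trace_eq_add_complexConj (z : K) :
    algebraMap (maximalRealSubfield K) K (Algebra.trace (maximalRealSubfield K) K z) = z + complexConj K z :=
  T5QuadraticTrace.algebraMap_trace_eq_add_apply (Algebra.IsQuadraticExtension.finrank_eq_two (maximalRealSubfield K) K) _
    (complexConj_ne_one K) z

/-- **The CM norm form**: `N_{K/K⁺} z = z · c z`. -/
theorem algebraMap_norm_eq_mul_complexConj (z : K) :
    algebraMap (maximalRealSubfield K) K (Algebra.norm (maximalRealSubfield K) z) = z * complexConj K z :=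
  T5QuadraticTrace.algebraMap_norm_eq_mul_apply (Algebra.IsQuadraticExtension.finrank_eq_two (maximalRealSubfield K) K) _
    (complexConj_ne_one K) z

/-- Under every complex embedding the CM norm is the square modulus: `φ (N z) = |φ z|²`. -/
theorem complexEmbedding_algebraMap_norm (φ : K →+* ℂ) (z : K) :
    φ (algebraMap (maximalRealSubfield K) K (Algebra.norm (maximalRealSubfield K) z)) = Complex.normSq (φ z) := by
  rw [algebraMap_norm_eq_mul_complexConj, map_mul, complexEmbedding_complexConj, Complex.mul_conj]

/-- At every infinite place `w` of `K`, `w (N z) = (w z)²`. -/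
theorem infinitePlace_algebraMap_norm (w : InfinitePlace K) (z : K) :
    w (algebraMap (maximalRealSubfield K) K (Algebra.norm (maximalRealSubfield K) z)) = w z ^ 2 := by
  rw [algebraMap_norm_eq_mul_complexConj, map_mul, infinitePlace_complexConj, sq]

/-- For a real embedding `ψ : maximalRealSubfield K →+* ℝ`, `ψ (N z) = |φ z|²` for any lift `φ` of `ψ` to `K`. -/
theorem realEmbedding_norm_eq_normSq (ψ : maximalRealSubfield K →+* ℝ) (z : K) :
    ψ (Algebra.norm (maximalRealSubfield K) z) =
      Complex.normSq (ComplexEmbedding.lift K (Complex.ofRealHom.comp ψ) z) := by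
  have h := complexEmbedding_algebraMap_norm K (ComplexEmbedding.lift K (Complex.ofRealHom.comp ψ)) z
  rw [ComplexEmbedding.lift_algebraMap_apply, RingHom.comp_apply, Complex.ofRealHom_eq_coe] at h
  exact_mod_cast h

/-- **Total positivity of the CM norm**: `0 ≤ ψ (N_{K/K⁺} z)` for every real embedding `ψ` of `K⁺`. -/
theorem realEmbedding_norm_nonneg (ψ : maximalRealSubfield K →+* ℝ) (z : K) : 0 ≤ ψ (Algebra.norm (maximalRealSubfield K) z) := by
  rw [realEmbedding_norm_eq_normSq]
  exact Complex.normSq_nonneg _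

/-- `ψ (N_{K/K⁺} z) > 0` for every real embedding `ψ` of `K⁺` iff `z ≠ 0`. -/
theorem realEmbedding_norm_pos_iff (ψ : maximalRealSubfield K →+* ℝ) (z : K) :
    0 < ψ (Algebra.norm (maximalRealSubfield K) z) ↔ z ≠ 0 := by
  rw [realEmbedding_norm_eq_normSq, Complex.normSq_pos, map_ne_zero]

/-- Every `ℚ`-embedding of the totally real field `K⁺` into `ℂ` takes real non-negative values on
`N_{K/K⁺} z`. -/
theorem embedding_norm_eq_ofReal (σ : maximalRealSubfield K →ₐ[ℚ] ℂ) (z : K) :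
    ∃ r : ℝ, 0 ≤ r ∧ σ (Algebra.norm (maximalRealSubfield K) z) = r := by
  have hσ : ComplexEmbedding.IsReal (σ : maximalRealSubfield K →+* ℂ) :=
    IsTotallyReal.complexEmbedding_isReal _
  refine ⟨hσ.embedding (Algebra.norm (maximalRealSubfield K) z), realEmbedding_norm_nonneg K _ z, ?_⟩
  rw [ComplexEmbedding.IsReal.coe_embedding_apply]
  rfl

/-- **The absolute norm of an element of a CM field is non-negative**: `0 ≤ N_{K/ℚ} z`. -/
theorem norm_rat_nonneg (z : K) : 0 ≤ Algebra.norm ℚ z := by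
  rw [← Algebra.norm_norm (S := maximalRealSubfield K)]
  set x : maximalRealSubfield K := Algebra.norm (maximalRealSubfield K) z
  choose r hr0 hr using fun σ : maximalRealSubfield K →ₐ[ℚ] ℂ => embedding_norm_eq_ofReal K σ z
  have h := Algebra.norm_eq_prod_embeddings ℚ ℂ x
  have h' : (algebraMap ℚ ℂ) (Algebra.norm ℚ x) = ((∏ σ, r σ : ℝ) : ℂ) := by
    rw [h, Complex.ofReal_prod]
    exact Finset.prod_congr rfl fun σ _ => hr σ
  have hprod : 0 ≤ ∏ σ, r σ := Finset.prod_nonneg fun σ _ => hr0 σ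
  have hq : ((Algebra.norm ℚ x : ℚ) : ℝ) = ∏ σ, r σ := by
    apply Complex.ofReal_injective
    rw [← h']
    simp
  have : (0 : ℝ) ≤ (Algebra.norm ℚ x : ℚ) := hq ▸ hprod
  exact_mod_cast this

end TraceNorm

section Cyclic

open T5CMTypeGaloisDialect

variable [IsGalois ℚ K]

/-- The complex conjugation, as a `ℚ`-automorphism (p7's `conjGal`), is not the identity. -/
theorem conjGal_ne_one : conjGal K ≠ 1 := by
  intro h
  apply complexConj_ne_one K
  ext z
  have := congrArg (fun τ : K ≃ₐ[ℚ] K => τ z) h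
  simpa [conjGal_apply] using this

/-- The complex conjugation has order `2` in `Gal(K/ℚ)`. -/
theorem orderOf_conjGal : orderOf (conjGal K) = 2 :=
  orderOf_eq_prime_iff.mpr ⟨by rw [pow_two]; exact conjGal_mul_self, conjGal_ne_one K⟩

variable [IsCyclic (K ≃ₐ[ℚ] K)]

/-- **In a cyclic Galois group the complex conjugation is THE involution**: every element of order
`2` of `Gal(K/ℚ)` is the complex conjugation. -/
theorem eq_conjGal_of_orderOf_eq_two {c : K ≃ₐ[ℚ] K} (hc : orderOf c = 2) : c = conjGal K :=
  T5DecompositionOrder.eq_of_orderOf_eq_two (orderOf_conjGal K) hc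

/-- **T4A §3.2's «c = gᵐ»**: for a generator `g` of the cyclic `Gal(K/ℚ)` of order `2m`, the complex
conjugation is `g ^ m`. -/
theorem conjGal_eq_pow {g : K ≃ₐ[ℚ] K} (hg : Subgroup.zpowers g = ⊤) {m : ℕ} (hm : 0 < m)
    (hcard : Nat.card (K ≃ₐ[ℚ] K) = 2 * m) : conjGal K = g ^ m := by
  have horder : orderOf g = 2 * m := by
    rw [← hcard, ← Nat.card_zpowers, hg, Subgroup.card_top]
  symm
  apply eq_conjGal_of_orderOf_eq_two
  apply orderOf_eq_prime_iff.mpr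
  refine ⟨?_, ?_⟩
  · rw [← pow_mul, mul_comm, ← horder, pow_orderOf_eq_one]
  · apply pow_ne_one_of_lt_orderOf hm.ne'
    rw [horder]
    omega

/-- **T4A §3.2's «c = g³»** for a cyclic `Gal(K/ℚ)` of order `6` (the sextic Galois CM case). -/
theorem conjGal_eq_pow_three {g : K ≃ₐ[ℚ] K} (hg : Subgroup.zpowers g = ⊤)
    (hcard : Nat.card (K ≃ₐ[ℚ] K) = 6) : conjGal K = g ^ 3 :=
  conjGal_eq_pow K hg (by norm_num) (by rw [hcard])

end Cyclic

end Summit.Ventures.HodgeRepro2.T5CMConjugation
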